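import Literature.AlgebraicGeometry.HodgeTheory.GeneralHodgePropertyDescendsAlongSurjections
import Literature.AlgebraicGeometry.HodgeTheory.SurjectivePushPullHodgeSplitting
import HarnessLib

/-!
# Twisted descent of Grothendieck's amended generalized Hodge conjecture along a surjection of
# relative dimension `r`: `GHC(X, i + 2r, c + r) ⟹ GHC(W, i, c)`

Family `hodge`, layer `Literature/AlgebraicGeometry/HodgeTheory`; lane `lit-hodgefound` (Track 2 foundations,
Layer A1). THEOREMS ONLY (no definition, no named fact; D-0026).

Companion of `GeneralHodgePropertyDescendsAlongSurjections` (`GHC(X, i, c) ⟹ GHC(W, i, c)` through `g^*`).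
Here the admissible subspace `W' ⊆ Fᶜ Hⁱ(W(ℂ); ℂ)` is transported to `Lʳ_η(g^* W') ⊆ F^{c+r} H^{i+2r}(X(ℂ); ℂ)`
(`η = D.Hη` the rational Kähler class of a Kähler–rational datum: `L_η` is rational of bidegree `(1, 1)`,
Voisin I Rem. 6.27 / §7.1.2), `GHC(X, i + 2r, c + r)` puts it in `N^{c+r} H^{i+2r}(X)`, the Gysin morphism
`g_*` lowers the codimension of supports by `r` (Voisin II Prop. 9.21 (ii), the tree's
`complexGysin_mem_supportedClasses`) and `g_*(Lʳ_η(g^* x)) = c₀ • x`, `c₀ ≠ 0` (Voisin I Lemma 7.28 with the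
wedge kept; the tree's `SurjectivePushPullSplitting`). This is the route by which the tree descends the
Hodge conjecture itself (`SurjectiveDescent.hodgeConjectureFor_of_surjective`: `HC(X)` in degree `2(p+r)` ⟹
`HC(W)` in degree `2p`).

* §1 `Lʳ_η` preserves admissibility (`η = D.Hη`): `KaehlerRationalDatum.isRationallySpanned_map_lefschetzPow`,
  `KaehlerRationalDatum.isSubHodge_map_lefschetzPow` (bidegree `(r, r)`),
  `KaehlerRationalDatum.map_lefschetzPow_hodgeFiltrationBetti_le` (`Lʳ_η Fᶜ Hⁱ ⊆ F^{c+r} H^{i+2r}`),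
  **`KaehlerRationalDatum.map_lefschetzPow_mem_ratSubHodgeInFilt`**.
* §2 **`generalHodgePropertyFor_of_surjective_of_add`** — `GHC(X, i + 2r, c + r) ⟹ GHC(W, i, c)` for
  `g : X ⟶ W` surjective with `dim X = dim W + r`; `hodgeConjectureFor_of_generalHodgePropertyFor_twisted`
  (`GHC(X, 2q, q)` for all `q ≥ r` ⟹ `HC(W)`).

## References

* [Arapura2006] D. Arapura, Motivation for Hodge cycles, Adv. Math. 207 (2006), §1 Cor. 1.2, §4 Lemma 4.2.
* [GrothendieckTopology1969] A. Grothendieck, Topology 8 (1969), pp. 299–301.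
* [VoisinHodgeI2002] [Voisin2002] C. Voisin, Hodge Theory and Complex Algebraic Geometry I, CUP 2002,
  §6.2.3 Rem. 6.27, §7.1.2, §7.3.1, §7.3.2 Lemma 7.28 and Remark 7.29, §11.3 Conj. 11.37.
* [VoisinHodgeII2003] C. Voisin, Hodge Theory and Complex Algebraic Geometry II, CUP 2003, §9.2.4 Prop. 9.20,
  Prop. 9.21 (ii).
-/

noncomputable section

open CategoryTheory AlgebraicGeometry
open Literature.AlgebraicTopology.SingularHomology
open Literature.Geometry.Kaehler
open Literature.AlgebraicGeometry.Motives (IsSmoothProjective ComplexPoints)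

namespace Literature.AlgebraicGeometry.HodgeTheory

variable {n m : ℕ} {X W : Motives.SchemeOver ℂ}

/-! ### §1 `Lʳ_η` preserves the admissibility conditions -/

namespace KaehlerRationalDatum

variable (D : KaehlerRationalDatum n X)

/-- `Lʳ_η c` is a rational class for `c` rational (`η = D.Hη` is rational; the tree's
`IsRationalClass.lefschetzPowTo` in the `lefschetzPow` spelling — cf. `Motives.isRationalClass_lefschetzPow`
for a general rational `η`, not imported here). [cite: VoisinHodgeI2002, §7.1.2] -/
private theorem isRationalClass_lefschetzPow {i : ℕ} (r : ℕ) {c : complexBetti X i} (hc : IsRationalClass c) :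
    IsRationalClass (lefschetzPow D.Hη r i c) := by
  rw [← lefschetzPowTo_eq_lefschetzPow]
  exact D.isRationalClass_Hη.lefschetzPowTo r i _ rfl hc

/-- `Lʳ_η c` is of Hodge type `(p + r, q + r)` for `c` of type `(p, q)` (the tree's
`isOfHodgeType_lefschetzPowTo` in the `lefschetzPow` spelling). [cite: VoisinHodgeI2002, §6.2.3 Rem. 6.27 and §7.1.2] -/
private theorem isOfHodgeType_lefschetzPow (hX : IsSmoothProjective n X) {i p q : ℕ} (r : ℕ) {c : complexBetti X i}
    (hc : IsOfHodgeType n X i p q c) : IsOfHodgeType n X (i + 2 * r) (p + r) (q + r) (lefschetzPow D.Hη r i c) := by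
  rw [← lefschetzPowTo_eq_lefschetzPow]
  exact D.isOfHodgeType_lefschetzPowTo hX r i _ rfl p q c hc

/-- **`Lʳ_η` of a rationally spanned subspace is rationally spanned.** [cite: VoisinHodgeI2002, §7.3.1 and §7.1.2] -/
theorem isRationallySpanned_map_lefschetzPow {i : ℕ} {W' : Submodule ℂ (complexBetti X i)}
    (hW' : IsRationallySpanned W') (r : ℕ) : IsRationallySpanned (W'.map (lefschetzPow D.Hη r i)) := by
  refine (isRationallySpanned_iff_le _).2 ?_
  conv_lhs => rw [hW']
  rw [Submodule.map_span]
  refine Submodule.span_mono ?_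
  rintro _ ⟨c, ⟨hc, hcQ⟩, rfl⟩
  exact ⟨Submodule.mem_map_of_mem hc, D.isRationalClass_lefschetzPow r hcQ⟩

/-- **`Lʳ_η` of a sub-Hodge structure is a sub-Hodge structure** (bidegree `(r, r)`; the image of a
sub-Hodge structure under a type-shifting map, `HodgeModel.IsSubHodge.map_of_hodgePQ`).
[cite: VoisinHodgeI2002, §7.3.1 and §6.2.3 Rem. 6.27] -/
theorem isSubHodge_map_lefschetzPow (B : HodgeModel n X) (hX : IsSmoothProjective n X) {i : ℕ}
    {W' : Submodule ℂ (complexBetti X i)} (hW' : B.IsSubHodge i (W'.map (B.pullback i).hom)) (r : ℕ) :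
    B.IsSubHodge (i + 2 * r) ((W'.map (lefschetzPow D.Hη r i)).map (B.pullback (i + 2 * r)).hom) :=
  hW'.map_of_hodgePQ B B (lefschetzPow D.Hη r i) fun p q hpq ↦ ⟨p + r, q + r, by omega, fun y hy ↦
    (isOfHodgeType_iff_mem_hodgePQ hX B _).1
      (D.isOfHodgeType_lefschetzPow hX r ((isOfHodgeType_iff_mem_hodgePQ hX B y).2 hy))⟩

/-- **`Lʳ_η Fᶜ Hⁱ(X) ⊆ F^{c+r} H^{i+2r}(X)`** for the Hodge filtrations read on `H(X(ℂ); ℂ)` through a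
Hodge model `B`. [cite: VoisinHodgeI2002, §7.1.1 and §6.2.3 Rem. 6.27] -/
theorem map_lefschetzPow_hodgeFiltrationBetti_le (B : HodgeModel n X) (hX : IsSmoothProjective n X)
    (i c r : ℕ) :
    (B.hodgeFiltrationBetti i c).map (lefschetzPow D.Hη r i) ≤ B.hodgeFiltrationBetti (i + 2 * r) (c + r) := by
  rintro _ ⟨x, hx, rfl⟩
  rw [SetLike.mem_coe, HodgeModel.mem_hodgeFiltrationBetti] at hx
  set S : Submodule ℂ (singularCohomology ℂ ℂ B.carrier i) :=
    ((B.hodgeFiltrationBetti (i + 2 * r) (c + r)).comap (lefschetzPow D.Hη r i)).map (B.pullback i).hom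
    with hS
  have hle : B.hodgeFiltration i c ≤ S := by
    refine iSup_le fun p ↦ iSup_le fun q ↦ iSup_le fun hpq ↦ iSup_le fun hcp ↦ fun z hz ↦ ?_
    obtain ⟨c₀, rfl⟩ := B.pullback_surjective i z
    refine ⟨c₀, ?_, rfl⟩
    change lefschetzPow D.Hη r i c₀ ∈ B.hodgeFiltrationBetti (i + 2 * r) (c + r)
    rw [HodgeModel.mem_hodgeFiltrationBetti]
    exact B.hodgePQ_le_hodgeFiltration (show (p + r) + (q + r) = i + 2 * r by omega) (by omega)
      ((isOfHodgeType_iff_mem_hodgePQ hX B _).1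
        (D.isOfHodgeType_lefschetzPow hX r ((isOfHodgeType_iff_mem_hodgePQ hX B c₀).2 hz)))
  obtain ⟨x', hx', hxx'⟩ := hle hx
  obtain rfl : x' = x := B.pullback_injective i hxx'
  exact hx'

/-- **`Lʳ_η` of an admissible subspace of `(Hⁱ, Fᶜ)` is an admissible subspace of `(H^{i+2r}, F^{c+r})`.**
[cite: VoisinHodgeI2002, §7.3.1 and §6.2.3 Rem. 6.27] [cite: GrothendieckTopology1969, p. 300] -/
theorem map_lefschetzPow_mem_ratSubHodgeInFilt (B : HodgeModel n X) (hX : IsSmoothProjective n X)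
    {i c : ℕ} {W' : Submodule ℂ (complexBetti X i)} (hW' : W' ∈ B.ratSubHodgeInFilt i c) (r : ℕ) :
    W'.map (lefschetzPow D.Hη r i) ∈ B.ratSubHodgeInFilt (i + 2 * r) (c + r) :=
  ⟨D.isRationallySpanned_map_lefschetzPow hW'.1 r, D.isSubHodge_map_lefschetzPow B hX hW'.2.1 r,
    (Submodule.map_mono hW'.2.2).trans (D.map_lefschetzPow_hodgeFiltrationBetti_le B hX i c r)⟩

end KaehlerRationalDatum

/-! ### §2 `GHC(X, i + 2r, c + r) ⟹ GHC(W, i, c)` along a surjection of relative dimension `r` -/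

/-- **TWISTED DESCENT OF THE AMENDED GENERALIZED HODGE CONJECTURE**: for `g : X ⟶ W` surjective between
smooth projective complex varieties with `dim X = dim W + r`, `GHC(X, i + 2r, c + r) ⟹ GHC(W, i, c)`. Given
an admissible `W' ⊆ Fᶜ Hⁱ(W(ℂ); ℂ)`, `Lʳ_η(g^* W') ⊆ F^{c+r} H^{i+2r}(X(ℂ); ℂ)` is admissible (§1 and
`HodgeModel.map_mem_ratSubHodgeInFilt`), `GHC(X, i + 2r, c + r)` puts it in `N^{c+r} H^{i+2r}(X)`, `g_*` maps
`N^{c+r} H^{i+2r}(X)` into `Nᶜ Hⁱ(W)` (`complexGysin_mem_supportedClasses`) and `x = c₀⁻¹ g_*(Lʳ_η(g^* x))`.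
In print (through motivated motives, for dominations by powers): Arapura, Lemma 4.2 with Cor. 1.2.
[cite: Arapura2006, §4 Lemma 4.2 (clause GHC) and §1 Cor. 1.2] [cite: GrothendieckTopology1969, p. 300]
[cite: Voisin2002, §7.3.2 Lemma 7.28 and Remark 7.29] [cite: VoisinHodgeII2003, §9.2.4 Prop. 9.20 and Prop. 9.21 (ii)] -/
theorem generalHodgePropertyFor_of_surjective_of_add (hX : IsSmoothProjective n X) (hW : IsSmoothProjective m W)
    (g : X ⟶ W) [Surjective g.left] {r : ℕ} (hr : m + r = n) {i c : ℕ}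
    (h : GeneralHodgePropertyFor n X (i + 2 * r) (c + r)) : GeneralHodgePropertyFor m W i c := by
  refine ⟨nonempty_hodgeModel_holds hW, fun A W' hW' x hx ↦ ?_⟩
  obtain ⟨B⟩ := h.1
  obtain ⟨D⟩ := nonempty_kaehlerRationalDatum hX
  obtain ⟨c₀, hc₀, hc⟩ := D.exists_complexGysin_lefschetzPow_map_eq_smul_of_surjective hX hW g hr
  have hadm := D.map_lefschetzPow_mem_ratSubHodgeInFilt B hX (A.map_mem_ratSubHodgeInFilt B hW hX g hW') r
  have hL : lefschetzPow D.Hη r i (complexBetti.map g i x) ∈ supportedClasses X (i + 2 * r) (c + r) :=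
    h.2 B _ hadm (Submodule.mem_map_of_mem (Submodule.mem_map_of_mem hx))
  have hg := complexGysin_mem_supportedClasses (gysinMap_restrictCompl_eq_zero_of_field ℂ)
    complexOrientationFamily hasPoincareDuality_complexOrientationFamily hX hW g
    (show (i + 2 * r) + 2 * m = i + 2 * n by omega) (r := c + r) (s := c) (by omega) hL
  rw [hc i x] at hg
  simpa only [inv_smul_smul₀ hc₀] using (supportedClasses W i c).smul_mem c₀⁻¹ hg

/-- **`GHC(X, 2q, q)` for all `q ≥ r` ⟹ the Hodge conjecture for every `W` dominated by `X` in relative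
dimension `r`** (twisted descent in the degrees `(2(p + r), p + r) ↦ (2p, p)`, then Grothendieck p. 301:
`GHC(W, 2p, p) ∀ p ⟹ HC(W)`). [cite: GrothendieckTopology1969, p. 301]
[cite: Arapura2006, §4 Lemma 4.2 and §1 Cor. 1.2] -/
theorem hodgeConjectureFor_of_generalHodgePropertyFor_twisted (hX : IsSmoothProjective n X)
    (hW : IsSmoothProjective m W) (g : X ⟶ W) [Surjective g.left] {r : ℕ} (hr : m + r = n)
    (h : ∀ q : ℕ, r ≤ q → GeneralHodgePropertyFor n X (2 * q) q) : HodgeConjectureFor m W := by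
  refine hodgeConjectureFor_of_generalHodgePropertyFor fun p ↦
    generalHodgePropertyFor_of_surjective_of_add hX hW g hr ?_
  have hq := h (p + r) (by omega)
  rwa [show 2 * (p + r) = 2 * p + 2 * r by ring] at hq

end Literature.AlgebraicGeometry.HodgeTheory

end
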